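import Summits.AtomisticToContinuum.HydrodynamicLimit.Theorems.AntiMazurCoboundariesCorrectorPressureDecayKiferWallLocalLimit
import Summits.AtomisticToContinuum.HydrodynamicLimit.Theorems.AntiMazurCoboundariesCorrectorPressureDecayTangentBiasHolds
import Summits.AtomisticToContinuum.HydrodynamicLimit.Theorems.AntiMazurCoboundariesCorrectorPressureDecayTangentTightnessClosed
import Literature.MathematicalPhysics.KineticTheory.RegularStationaryState

/-!
# Strategy census (crux-strategist s1) — STRENGTHEN and the local-limit DECOMPOSITION, typed

Crux stmt-AtomisticToContinuum-14135 `AntiMazurCoboundaries.CorrectorPressureDecay` ("X"). Companion of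
`STRATEGY-CENSUS.md` §Strengthen / §Decomposition (D-LL).

* `StationaryEBP` (S⁺⁺): the Entropic Boltzmann Property for REGULAR STATIONARY STATES of an equilibrium infinite
  hard-sphere flow (tree vocabulary `InfiniteHardSphereFlow`, `RegularStationaryState`, Alexander 1976 / Bernardin 2014
  Def. 1): the form in which the only interacting classification theorems are stated (Gurevich–Suhov: Gibbsian stationary
  states; OVY 1993 §4 (B)–(D): velocity-uncorrelated states, WITH noise at step (B)). Typed to show what "more rigidity"
  means here — exact stationarity under the infinite dynamics instead of being a tangent state — and recorded as buying
  nothing: it is the one-body, entropy-priced shadow of the Boltzmann hypothesis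
  (`Literature.Barriers.AtomisticToContinuum.BoltzmannHypothesisBarrierNarrow`), and it is not even comparable with the
  line's wall (tangent states need not be flow-defined; stationary states need not be tangent).
* `split_localLimitWall` (D-LL): the best typed split of X whose glue is IN THE TREE — X from the local-limit entropy bound
  `TangentEntropyBoundLocal` (infrastructure) and the wall with respect to canonical local limits
  `EntropicBoltzmannPropertyWrt IsCanonicalLocalLimitRef` (lead c8, p156257), given the compactness half
  `CanonicalBlowUpLocallyCompact` (a theorem as of 2026-08-17 ~12Z, composition file landing). One piece (the wall) keeps
  the entire dynamical content of X.
-/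

noncomputable section

open MeasureTheory ProbabilityTheory Set Filter Topology
open scoped ENNReal

namespace Summit.AtomisticToContinuum.HydrodynamicLimit.Cruxes.CorrectorPressureDecay.StrategyCensus

open Literature.MathematicalPhysics.KineticTheory (T3 V3 hsDiameter localGibbsLaw RegularStationaryState)
open Literature.MathematicalPhysics.KineticTheory.PointProcess (specificRelEntropy)
open Literature.Analysis.FluidPDE (HardSphereFlow Config IsHardSphereGibbs IsTranslationInvariant windowSumReal
  InfiniteHardSphereFlow)
open Literature.Analysis.FunctionSpaces (PointConfig)
open Summit.AtomisticToContinuum.HydrodynamicLimit.Theorems.KiferCompactification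
open Summit.AtomisticToContinuum.HydrodynamicLimit.Theses.AntiMazurCoboundaries (CorrectorPressureDecay)

/-- **S⁺⁺ — THE STATIONARY ENTROPIC BOLTZMANN PROPERTY** (census §Strengthen): for every `θ, u₀` there are `z₀, κ > 0`
such that for every EQUILIBRIUM infinite hard-sphere flow `Φ` (unit diameter) and every REGULAR STATIONARY STATE `μ` of
`Φ` (probability, translation invariant, `Φ`-a.e. defined and `Φ`-invariant, finite density / kinetic-energy density,
entropy-regular), the fast one-body bias per unit volume is priced by the specific relative entropy with respect to every
translation-invariant dilute Gibbs state of activity `z < z₀` at `(θ⁻¹, u₀)`: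
`ofReal |E_μ[Σ_{p ∈ ω ∩ [0,1)³×ℝ³} g((p.2 − u₀)/√θ)]| ≤ h(μ | G)` for admissible `g` (`|g| ≤ κ`, `g ⊥ 1, v, |v|²`).
Zero on Gibbs mixtures; false for the ideal gas and for `d = 1` rods exactly as X is. Posited for the census only. -/
def StationaryEBP : Prop :=
  ∀ (θ : ℝ) (u₀ : V3), 0 < θ → ∃ z₀ : ℝ, 0 < z₀ ∧ ∃ κ : ℝ, 0 < κ ∧
  ∀ (Φ : InfiniteHardSphereFlow (Fin 3) 1), Φ.IsEquilibriumFlow →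
  ∀ (μ : Measure (PointConfig (V3 × V3))), RegularStationaryState Φ μ →
  ∀ (z : ℝ) (G : Measure (PointConfig (V3 × V3))), 0 < z → z < z₀ →
    IsHardSphereGibbs 1 z θ⁻¹ u₀ G → IsTranslationInvariant G →
  ∀ (g : V3 → ℝ), Continuous g → (∀ v, |g v| ≤ κ) →
    (∀ (c₀ c₂ : ℝ) (b : V3), ∫ v, g v * (c₀ + inner ℝ b v + c₂ * ‖v‖ ^ 2) ∂(stdGaussian V3) = 0) →
    ENNReal.ofReal |∫ ω, windowSumReal ω (Literature.Analysis.FunctionSpaces.Torus.unitCube (Fin 3))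
        (fun p => g ((Real.sqrt θ)⁻¹ • (p.2 - u₀))) ∂μ| ≤ specificRelEntropy μ G

/-- **D-LL — THE LOCAL-LIMIT SPLIT OF THE CRUX (glue in the tree).** With tightness and bias continuity of tangent states
THEOREMS (`stub_tangentTightness` p144923, `stub_tangentBias` p143314) and the compactness half (E1) of the canonical
local limit supplied, X follows from exactly two posited statements: the local-limit entropy bound (infrastructure:
lower semicontinuity / cell super-additivity of the specific relative entropy) and the wall with respect to canonical
local limits. Pure composition of the lead's `correctorPressureDecay_of_localLimitWall` (p156257). -/
theorem split_localLimitWall (hC : CanonicalBlowUpLocallyCompact) :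
    TangentEntropyBoundLocal → EntropicBoltzmannPropertyWrt IsCanonicalLocalLimitRef → CorrectorPressureDecay :=
  fun hL hW => correctorPressureDecay_of_localLimitWall stub_tangentTightness stub_tangentBias hC hL hW

end Summit.AtomisticToContinuum.HydrodynamicLimit.Cruxes.CorrectorPressureDecay.StrategyCensus

end
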